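import Summits.BirchSwinnertonDyer.BirchSwinnertonDyer.Theorems.EisensteinPrimesCharacterLambdaBookkeeping
import Summits.BirchSwinnertonDyer.Rank1Residual.X2.AnalyticInvariants
import Summits.BirchSwinnertonDyer.Rank1Residual.X2.GreenbergVatsalAnalyticTransferCore
import Literature.NumberTheory.EllipticCurves.GreenbergVatsal2000.EisensteinCongruence
import Literature.NumberTheory.EllipticCurves.Wuthrich2014.ReducibleMultiplicativeDivisibility
import Literature.NumberTheory.EllipticCurves.Wuthrich2014.PAdicBSDInequalityProofs
import Literature.NumberTheory.EllipticCurves.KatoRankBoundProofs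
import Literature.NumberTheory.EllipticCurves.IwasawaSelmerDualProofs
import Literature.NumberTheory.EllipticCurves.Rank1Residual.GVParityTwistProofs
import HarnessLib

/-!
# Crux 3 `MazurMCOnCellB` (stmt-BirchSwinnertonDyer-19033), line `twistback` — KERNEL F1, part B:
# Greenberg–Vatsal's analytic λ-formula at an odd MULTIPLICATIVE Eisenstein prime FROM CHARACTER DATA, and the
# first kernel PRODUCER of the two-engine certificate `X2.AnalyticMuLE W p 0 ∧ X2.AnalyticLambdaEq W p n`

LEAD bsd-line-x2-p1 g10 (2026-08-28). HONEST FRAMING (cell `bsd-eis`, run/shared/lean/pub/bsd-eis/): conditional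
theorems only (named facts BY NAME: GV Thm. (3.11)+(28) = `thm311_hasUnitContent_iff_and_order_eq_of_lineRamifiedEven`
(F1, PUBLISHED, the curve's only contact with the analytic side), Wuthrich 2014 Thm. 16 (integrality; conjunct 15 of
the route's `PublishedInputs`); F0 = Kubota–Leopoldt existence is the tree's THEOREM `exists_isCharacterLFunctionC/D`);
no `def`, no `sorry`; no main conjecture and no BSD is proved for any curve; 0 cells / labels / tiers move.

WHAT. For `W/ℚ` globally minimal, `p` odd MULTIPLICATIVE, `Φ₀ ≤ W[p]` a rational line RAMIFIED at `p` and EVEN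
(so the pair is of Greenberg–Vatsal parity type) with characters `φ` (of `Φ₀`, primitive mod `m`, `p ∣ m`) and `ψ`
(of `W[p]/Φ₀`, primitive mod `d`, `p ∤ d`) read through the cyclotomic characters, `Σ₀ = S₀ ∌ p` ⊇ the bad places
`≠ p`, and `b ∈ Λ` with `ι b = ϖ·L_p(E,T)` (THE Mazur–Tate–Teitelbaum function, Néron-normalised):

* §1 `hasUnitContent_iff_and_order_eq_of_lineRamifiedEven` — **`μ(ϖL) = 0 ⟺ μ(L_∅(C)) = μ(L_∅(D)) = 0`, and then
  `λ(ϖL) + Σ_{ℓ∈Σ₀} δ_E^{(ℓ)} = λ(L_∅(C)) + λ(L_∅(D)) + Σ_{ℓ∈Σ₀} s_ℓ([φ(ℓ) ≡ ℓ] + [ψ(ℓ) ≡ ℓ])`** — GV's p. 43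
  assembly `λ^{anal}_{E,Σ₀} = λ_{φ,Σ₀} + λ_{ψ,Σ₀}` with EVERY Σ₀-term made an explicit local integer (curve side:
  display (9), tree `EulerFactorInvariants.order_map_toZMod_mul_eulerFactorProduct`; character side: part A) and the
  PRIMITIVE character functions isolated. `L_∅(C)`, `L_∅(D)` are both the Kubota–Leopoldt function of the even
  character `φ = ωψ⁻¹` read in the two orientations (GV (26)/(27)).
* §2 `hasUnitContent_and_order_eq_of_lineRamifiedEven_of_klFlat` — **KL-FLAT**: if the two numbers `L_∅(C,0) =
  −B_{1,φω⁻¹}` and `L_∅(D,0) = −2B_{1,ψ⁻¹·1_{p∤·}}` are `p`-adic units (for the curve both are `∓(1 − ψ(p))B_{1,ψ}` up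
  to `2`: `p` "inert" for `ψ` and `p ∤` the `ψ`-class number), then `μ(ϖL) = 0` and
  `λ(ϖL) = Σ_{ℓ∈Σ₀} s_ℓ([φ(ℓ) ≡ ℓ] + [ψ(ℓ) ≡ ℓ]) − Σ_{ℓ∈Σ₀} δ_E^{(ℓ)}` — a LOCAL integer, no `p`-adic `L`-function
  of `E` computed.
* §3 `exists_integral_of_reducible` (Wuthrich Thm. 16 with the tree's cyclotomic datum and Selmer dual: some
  `b ∈ Λ` has `ι b = ϖ·L`) and **`analyticMuLE_zero_and_analyticLambdaEq_of_lineRamifiedEven_of_klFlat`**: under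
  KL-flat, `X2.AnalyticMuLE W p 0 ∧ X2.AnalyticLambdaEq W p n` for the `n` with
  `n + Σ_ℓ δ_E^{(ℓ)} = Σ_ℓ s_ℓ([φ(ℓ) ≡ ℓ] + [ψ(ℓ) ≡ ℓ])` — the census's two-engine reading `(μ_an, λ_an) = (0, n)`
  as a THEOREM of the pair's character data (the first producer of these typed certificates in the tree; so far
  they were per-pair inputs of `X2.bsdp_of_cellC_of_not_split_of_lamMin`, `…TwistbackOnePartnerCertificates` §3(ii)/§5).

USE (twistback, LEAD g9 verdict §4′, 51/51 on the census): at a NON-split rank-one partner `V = E^K` of an X2b pair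
(`ψ(p) = −1` forced), KL-flat is `p ∤ h`-type data of ONE quadratic field and `n = c(E)` is `K`-independent; on the
sub-row `c(E) = 1` this file + p640749 §3(ii) give the partner's upper half, hence stub 6 (∃-PARTNER) at `(E, p)` from
ONE admissible `K` with `r_an(E^K) = 1` and `p ∤ (1 − χ(p))B_{1,χ}` (door: part C). Nothing about any curve is
proved unconditionally here.

References: [GreenbergVatsal2000] §1 (9) p. 9, §2 Prop. (2.4), (16) p. 30, §3 Thm. (3.11), (26)–(28) pp. 41–43;
[Wuthrich2014] Thm. 16; [LangCyclotomic1990] Ch. 4 §3 Thm. 3.2; [Greenberg2001PastPresent] §4; [Washington1997]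
§7.1, §13.
-/

set_option autoImplicit false

-- `Summit.BirchSwinnertonDyer.BirchSwinnertonDyer.…`: the summit and its single sub-problem share a name.
set_option linter.dupNamespace false

noncomputable section

open scoped Classical MatrixGroups ModularForm

open NumberField IsDedekindDomain Field WeierstrassCurve CongruenceSubgroup PowerSeries
  Literature.NumberTheory.EllipticCurves Literature.NumberTheory.GaloisRepresentations
  Literature.NumberTheory.EllipticCurves.ModularForms
  Literature.NumberTheory.EllipticCurves.Rank1Residual
  Literature.NumberTheory.EllipticCurves.GreenbergVatsal2000
  Literature.NumberTheory.EllipticCurves.Wuthrich2014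
  Summit.BirchSwinnertonDyer.Rank1Residual
  Summit.BirchSwinnertonDyer.Rank1Residual.X2.EulerFactorAlgebra
  Summit.BirchSwinnertonDyer.Rank1Residual.X2.EulerFactorInvariants
  Summit.BirchSwinnertonDyer.Rank1Residual.X2.GreenbergVatsalAnalyticTransferCore
  Summit.BirchSwinnertonDyer.BirchSwinnertonDyer.Theorems.EisensteinPrimesCharacterEulerDepletion

namespace Summit.BirchSwinnertonDyer.BirchSwinnertonDyer.Theorems.EisensteinPrimesLambdaFromCharacters

variable (W : WeierstrassCurve ℚ) [W.IsGloballyMinimal] [W.IsElliptic] (p : ℕ) [hp : Fact p.Prime]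

/-! ## §1. GV's λ-formula at `p ‖ N` with explicit local terms and the primitive character functions isolated -/

/-- **Greenberg–Vatsal's analytic assembly at an odd multiplicative Eisenstein prime, character side explicit.**
Data: `W/ℚ` globally minimal, `p ≠ 2` multiplicative, `Φ₀ ≤ W[p]` a rational line ramified at `p` and even with
characters `φ` (primitive mod `m`) on `Φ₀` and `ψ` (primitive mod `d`) on `W[p]/Φ₀`, `f` the newform, `S₀ ∌ p`
finite containing the bad places `≠ p`, `ϖ·Ω_E = Ω⁺_f`, `L` THE Mazur–Tate–Teitelbaum function, `b ∈ Λ` with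
`ι b = ϖ·L`, and ANY primitive character functions `g_C = L_∅(C,T)`, `g_D = L_∅(D,T)`. Then (i) `b` has unit content
iff `g_C` and `g_D` do (GV: `μ^{anal}_E = 0` ⟸ Ferrero–Washington); (ii) in that case
`ord_T(b̄) + Σ_{ℓ∈S₀} δ_E^{(ℓ)} = ord_T(ḡ_C) + ord_T(ḡ_D) + Σ_{ℓ∈S₀} s_ℓ([φ(ℓ) = ℓ̄] + [ψ(ℓ) = ℓ̄])`. Proof: GV
Thm. (3.11)+(28) (`h311`, named fact F1) compares `b·∏𝒫_ℓ` with `L_{S₀}(C)·L_{S₀}(D)` (F0 existence is the tree's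
theorem); display (9) on the curve side; part A on the character side. [cite: GreenbergVatsal2000, §3 Thm. (3.11) (p. 43) with (26)–(28) (pp. 41–42), §1 (9), §2 Prop. (2.4)] -/
theorem hasUnitContent_iff_and_order_eq_of_lineRamifiedEven
    (h311 : thm311_hasUnitContent_iff_and_order_eq_of_lineRamifiedEven)
    {N : ℕ} [NeZero N] (f : CuspForm (Gamma0 N) 2) (S₀ : Finset (HeightOneSpectrum (𝓞 ℚ)))
    (Φ₀ : AddSubgroup (W.geomTorsion (p : ℤ)))
    (m : ℕ) [NeZero m] (φ : DirichletCharacter (ZMod p) m)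
    (d : ℕ) [NeZero d] (ψ : DirichletCharacter (ZMod p) d)
    (hp2 : p ≠ 2) (hmult : W.HasMultiplicativeReductionAtPrime p)
    (hΦ : IsRationalLine W p Φ₀) (hram : ¬ LineUnramifiedAt W p Φ₀) (heven : LineEven W p Φ₀)
    (hf : IsNewformOf W f) (hφ : φ.IsPrimitive) (hψ : ψ.IsPrimitive) (hpm : p ∣ m) (hpd : ¬ p ∣ d)
    (hφ0 : ∀ (σ : absoluteGaloisGroup ℚ), ∀ P ∈ Φ₀,
      σ • P = (φ ((modNCyclotomicCharacter ℚ m σ : (ZMod m)ˣ) : ZMod m)).val • P)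
    (hψ0 : ∀ (σ : absoluteGaloisGroup ℚ) (P : W.geomTorsion (p : ℤ)),
      σ • P - (ψ ((modNCyclotomicCharacter ℚ d σ : (ZMod d)ˣ) : ZMod d)).val • P ∈ Φ₀)
    (hS₀p : ∀ v ∈ S₀, ((p : ℕ) : 𝓞 ℚ) ∉ v.asIdeal)
    (hS : ∀ v : HeightOneSpectrum (𝓞 ℚ), v ∉ S₀ → ((p : ℕ) : 𝓞 ℚ) ∉ v.asIdeal → W.HasGoodReductionAt v)
    (ϖ : ℚ) (hϖ : (ϖ : ℝ) * W.realPeriodRat = plusPeriod f) (L : PowerSeries ℚ_[p])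
    (hLs : W.HasSplitMultiplicativeReductionAtPrime p → IsSplitMultPAdicLFunctionOf f p L)
    (hLns : ¬ W.HasSplitMultiplicativeReductionAtPrime p → IsMultPAdicLFunctionOf f p (-1) L)
    (b : IwasawaAlgebra p) (hb : iwasawaToPowerSeries p b = PowerSeries.C ((ϖ : ℚ) : ℚ_[p]) * L)
    {gC₀ gD₀ : IwasawaAlgebra p} (hgC₀ : IsCharacterLFunctionC p φ ∅ gC₀)
    (hgD₀ : IsCharacterLFunctionD p ψ ∅ gD₀) :
    (HasUnitContent b ↔ HasUnitContent gC₀ ∧ HasUnitContent gD₀) ∧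
      (HasUnitContent b →
        (PowerSeries.map (PadicInt.toZMod (p := p)) b).order + ((∑ v ∈ S₀, delta W p v : ℕ) : ℕ∞) =
          (PowerSeries.map (PadicInt.toZMod (p := p)) gC₀).order +
            (PowerSeries.map (PadicInt.toZMod (p := p)) gD₀).order +
            ((∑ v ∈ S₀, ((if φ (Rat.HeightOneSpectrum.natGenerator v : ZMod m) =
                (Rat.HeightOneSpectrum.natGenerator v : ZMod p)
              then sFactor p (Rat.HeightOneSpectrum.natGenerator v) else 0) +
              (if ψ (Rat.HeightOneSpectrum.natGenerator v : ZMod d) =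
                (Rat.HeightOneSpectrum.natGenerator v : ZMod p)
              then sFactor p (Rat.HeightOneSpectrum.natGenerator v) else 0)) : ℕ) : ℕ∞)) := by
  have hS' : ∀ v ∈ S₀, Rat.HeightOneSpectrum.natGenerator v ≠ p :=
    fun v hv ↦ natGenerator_ne_of_natCast_not_mem v (hS₀p v hv)
  -- (F0) the `S₀`-depleted character functions exist (THEOREMS of the tree)
  obtain ⟨gC, hgC⟩ := exists_isCharacterLFunctionC p φ S₀ hp2 hpm hφ
  obtain ⟨gD, hgD⟩ := exists_isCharacterLFunctionD p ψ S₀ hp2 hpd hS₀p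
  -- (F1) GV Thm. (3.11) + (28)
  obtain ⟨hiff, hord⟩ := h311 W p f S₀ Φ₀ m φ d ψ hp2 (Or.inr hmult) hΦ hram heven hf hφ hψ hφ0 hψ0
    hS₀p hS ϖ hϖ L
    (fun hgood ↦ absurd hgood
      (WeierstrassCurve.HasMultiplicativeReduction.not_hasGoodReduction (R := ℤ_[p]) hmult))
    hLs (fun _ hns ↦ hLns hns) b hb gC gD hgC hgD
  -- part A: the character-side bookkeeping against the PRIMITIVE functions
  obtain ⟨hCiff, hCord⟩ := hasUnitContent_iff_and_order_eq_charFunctionC p φ S₀ hp2 hS₀p hgC hgC₀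
  obtain ⟨hDiff, hDord⟩ := hasUnitContent_iff_and_order_eq_charFunctionD p ψ S₀ hp2 hS₀p hgD hgD₀
  -- curve side: display (9)
  have hEiff := hasUnitContent_mul_eulerFactorProduct_iff W S₀ hp2 hS' b
  have hEord := order_map_toZMod_mul_eulerFactorProduct W S₀ hp2 hS' b
  refine ⟨?_, fun hbu ↦ ?_⟩
  · rw [← hEiff, hiff, hasUnitContent_mul_iff, hCiff, hDiff]
  · have hCD : HasUnitContent (gC * gD) := hiff.mp (hEiff.mpr hbu)
    have h := hord hCD
    rw [hEord, map_mul, PowerSeries.order_mul, hCord, hDord] at h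
    rw [h, Finset.sum_add_distrib, Nat.cast_add]
    ring

/-! ## §2. KL-flat: both primitive values at `T = 0` are units ⟹ `μ(ϖL) = 0`, `λ(ϖL) = Σ(δ^C + δ^D) − Σ δ_E` -/

/-- **KL-flat ⟹ unit content and an EXPLICIT LOCAL `λ`**: in the setting of §1, if `‖L_∅(C, 0)‖ = 1` and
`‖L_∅(D, 0)‖ = 1` (`characterLValueC p φ ∅ 1`, `characterLValueD p ψ ∅ 1` — ONE generalized Bernoulli number each,
`−B_{1,φω⁻¹}` and `−2B_{1,ψ⁻¹·1_{p∤·}}`; for the curve `φω⁻¹ = ψ⁻¹`, so both say "`p ∤ (1 − ψ⁻¹(p))·B_{1,ψ⁻¹}`"),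
then `b` has unit content (`μ^{anal}_E = 0`) and `ord_T(b̄) + Σ_{ℓ∈S₀} δ_E^{(ℓ)} = Σ_{ℓ∈S₀} s_ℓ([φ(ℓ) = ℓ̄] + [ψ(ℓ) = ℓ̄])`.
No `p`-adic `L`-function of `E` is evaluated: the inputs are character data and local data at the bad primes.
[cite: GreenbergVatsal2000, §3 Thm. (3.11) (p. 43) with (26)–(28), §1 (9), §2 Prop. (2.4)]
[cite: Greenberg2001PastPresent, §4 pp. 355–356] [cite: LangCyclotomic1990, Ch. 4 §3 Thm. 3.2] -/
theorem hasUnitContent_and_order_eq_of_lineRamifiedEven_of_klFlat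
    (h311 : thm311_hasUnitContent_iff_and_order_eq_of_lineRamifiedEven)
    {N : ℕ} [NeZero N] (f : CuspForm (Gamma0 N) 2) (S₀ : Finset (HeightOneSpectrum (𝓞 ℚ)))
    (Φ₀ : AddSubgroup (W.geomTorsion (p : ℤ)))
    (m : ℕ) [NeZero m] (φ : DirichletCharacter (ZMod p) m)
    (d : ℕ) [NeZero d] (ψ : DirichletCharacter (ZMod p) d)
    (hp2 : p ≠ 2) (hmult : W.HasMultiplicativeReductionAtPrime p)
    (hΦ : IsRationalLine W p Φ₀) (hram : ¬ LineUnramifiedAt W p Φ₀) (heven : LineEven W p Φ₀)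
    (hf : IsNewformOf W f) (hφ : φ.IsPrimitive) (hψ : ψ.IsPrimitive) (hpm : p ∣ m) (hpd : ¬ p ∣ d)
    (hφ0 : ∀ (σ : absoluteGaloisGroup ℚ), ∀ P ∈ Φ₀,
      σ • P = (φ ((modNCyclotomicCharacter ℚ m σ : (ZMod m)ˣ) : ZMod m)).val • P)
    (hψ0 : ∀ (σ : absoluteGaloisGroup ℚ) (P : W.geomTorsion (p : ℤ)),
      σ • P - (ψ ((modNCyclotomicCharacter ℚ d σ : (ZMod d)ˣ) : ZMod d)).val • P ∈ Φ₀)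
    (hS₀p : ∀ v ∈ S₀, ((p : ℕ) : 𝓞 ℚ) ∉ v.asIdeal)
    (hS : ∀ v : HeightOneSpectrum (𝓞 ℚ), v ∉ S₀ → ((p : ℕ) : 𝓞 ℚ) ∉ v.asIdeal → W.HasGoodReductionAt v)
    (hC1 : ‖characterLValueC p φ ∅ 1‖ = 1) (hD1 : ‖characterLValueD p ψ ∅ 1‖ = 1)
    (ϖ : ℚ) (hϖ : (ϖ : ℝ) * W.realPeriodRat = plusPeriod f) (L : PowerSeries ℚ_[p])
    (hLs : W.HasSplitMultiplicativeReductionAtPrime p → IsSplitMultPAdicLFunctionOf f p L)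
    (hLns : ¬ W.HasSplitMultiplicativeReductionAtPrime p → IsMultPAdicLFunctionOf f p (-1) L)
    (b : IwasawaAlgebra p) (hb : iwasawaToPowerSeries p b = PowerSeries.C ((ϖ : ℚ) : ℚ_[p]) * L) :
    HasUnitContent b ∧
      (PowerSeries.map (PadicInt.toZMod (p := p)) b).order + ((∑ v ∈ S₀, delta W p v : ℕ) : ℕ∞) =
        ((∑ v ∈ S₀, ((if φ (Rat.HeightOneSpectrum.natGenerator v : ZMod m) =
            (Rat.HeightOneSpectrum.natGenerator v : ZMod p)
          then sFactor p (Rat.HeightOneSpectrum.natGenerator v) else 0) +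
          (if ψ (Rat.HeightOneSpectrum.natGenerator v : ZMod d) =
            (Rat.HeightOneSpectrum.natGenerator v : ZMod p)
          then sFactor p (Rat.HeightOneSpectrum.natGenerator v) else 0)) : ℕ) : ℕ∞) := by
  -- the primitive character functions (F0, THEOREMS) and their KL-flat invariants (part A §6 at `S₀ = ∅`)
  obtain ⟨gC₀, hgC₀⟩ := exists_isCharacterLFunctionC p φ ∅ hp2 hpm hφ
  obtain ⟨gD₀, hgD₀⟩ := exists_isCharacterLFunctionD p ψ ∅ hp2 hpd (by simp)
  obtain ⟨hCu, hCo⟩ := hasUnitContent_and_order_eq_charFunctionC_of_norm_eq_one p φ ∅ hp2 (by simp)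
    hgC₀ hgC₀ hC1
  obtain ⟨hDu, hDo⟩ := hasUnitContent_and_order_eq_charFunctionD_of_norm_eq_one p ψ ∅ hp2 (by simp)
    hgD₀ hgD₀ hD1
  rw [Finset.sum_empty, Nat.cast_zero] at hCo hDo
  obtain ⟨hiff, hord⟩ := hasUnitContent_iff_and_order_eq_of_lineRamifiedEven W p h311 f S₀ Φ₀ m φ d ψ
    hp2 hmult hΦ hram heven hf hφ hψ hpm hpd hφ0 hψ0 hS₀p hS ϖ hϖ L hLs hLns b hb hgC₀ hgD₀
  have hbu : HasUnitContent b := hiff.mpr ⟨hCu, hDu⟩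
  refine ⟨hbu, ?_⟩
  rw [hord hbu, hCo, hDo, zero_add, zero_add]

/-! ## §3. The two-engine certificate `(μ_an, λ_an) = (0, n)` as a THEOREM of the character data -/

/-- **Integrality at a reducible multiplicative prime (Wuthrich 2014 Thm. 16), packaged**: for `W/ℚ` globally
minimal, `p ≠ 2` multiplicative with `E[p]` reducible, every newform `f` of `W`, `ϖ` with `ϖ·Ω_E = Ω⁺_f` and THE
Mazur–Tate–Teitelbaum function `L`, some `b ∈ Λ` has `ι b = ϖ·L` (`b = g` or `T·g` with `g ∈ char_Λ X(E/ℚ_∞)`, at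
the tree's cyclotomic datum `exists_isCyclotomic_isTopGenerator_isCyclotomicVariable_holds` and Selmer dual
`nonempty_selmerDualData_holds`). [cite: Wuthrich2014, Thm. 16 (p. 397) and Cor. 18] -/
theorem exists_integral_of_reducible (hWu : thm16_charIdeal_dvd_multiplicative_of_reducible)
    (hp2 : p ≠ 2) (hmult : W.HasMultiplicativeReductionAtPrime p) (hred : ¬ W.HasIrreducibleModPGaloisRep p)
    {N : ℕ} [NeZero N] (f : CuspForm (Gamma0 N) 2) (hf : IsNewformOf W f)
    (ϖ : ℚ) (hϖ : (ϖ : ℝ) * W.realPeriodRat = plusPeriod f) (L : PowerSeries ℚ_[p])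
    (hLs : W.HasSplitMultiplicativeReductionAtPrime p → IsSplitMultPAdicLFunctionOf f p L)
    (hLns : ¬ W.HasSplitMultiplicativeReductionAtPrime p → IsMultPAdicLFunctionOf f p (-1) L) :
    ∃ b : IwasawaAlgebra p, iwasawaToPowerSeries p b = PowerSeries.C ((ϖ : ℚ) : ℚ_[p]) * L := by
  obtain ⟨κ, hκ, γ, hγ, hγ'⟩ := exists_isCyclotomic_isTopGenerator_isCyclotomicVariable_holds p
  obtain ⟨D⟩ := W.nonempty_selmerDualData_holds κ γ hγ
  obtain ⟨-, hKns, hKs⟩ := hWu W p hp2 hmult hred hκ hγ hγ' hf D ϖ hϖ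
  by_cases hs : W.HasSplitMultiplicativeReductionAtPrime p
  · obtain ⟨g, -, hg⟩ := hKs hs L (hLs hs)
    exact ⟨PowerSeries.X * g, hg⟩
  · obtain ⟨g, -, hg⟩ := hKns hs L (hLns hs)
    exact ⟨g, hg⟩

/-- **KL-flat ⟹ `(μ_an, λ_an)(E, p) = (0, n)` IN THE TREE'S TYPED CURRENCY** (`X2.AnalyticMuLE W p 0`,
`X2.AnalyticLambdaEq W p n`): in the setting of §1–§2 (ramified-even line with primitive characters `φ`, `ψ`;
`S₀ ∌ p` ⊇ bad places `≠ p`; GV Thm. (3.11) `h311`; Wuthrich Thm. 16 `hWu` for integrality), if both primitive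
character values at `T = 0` are `p`-adic units and `n + Σ_{ℓ∈S₀} δ_E^{(ℓ)} = Σ_{ℓ∈S₀} s_ℓ([φ(ℓ) = ℓ̄] + [ψ(ℓ) = ℓ̄])`,
then `μ_an = 0` (some coefficient of `ϖ·L` has norm `> p⁻¹`) and `λ_an = n` (every `G ∈ Λ` with `ι G = ϖ·L` has
`λ(G) = n`; `ι` injective). The FIRST producer of these certificates from structure: so far they were per-pair
inputs (`X2.bsdp_of_cellC_of_not_split_of_lamMin`, `…OnePartnerCertificates` §3(ii)/§5).
[cite: GreenbergVatsal2000, §3 Thm. (3.11) (p. 43) with (26)–(28), §1 (9), §2 Prop. (2.4), p. 2–3 (1)–(2)]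
[cite: Wuthrich2014, Thm. 16 (p. 397)] [cite: Greenberg2001PastPresent, §4 pp. 355–356] -/
theorem analyticMuLE_zero_and_analyticLambdaEq_of_lineRamifiedEven_of_klFlat
    (h311 : thm311_hasUnitContent_iff_and_order_eq_of_lineRamifiedEven)
    (hWu : thm16_charIdeal_dvd_multiplicative_of_reducible)
    (S₀ : Finset (HeightOneSpectrum (𝓞 ℚ))) (Φ₀ : AddSubgroup (W.geomTorsion (p : ℤ)))
    (m : ℕ) [NeZero m] (φ : DirichletCharacter (ZMod p) m)
    (d : ℕ) [NeZero d] (ψ : DirichletCharacter (ZMod p) d)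
    (hp2 : p ≠ 2) (hmult : W.HasMultiplicativeReductionAtPrime p)
    (hΦ : IsRationalLine W p Φ₀) (hram : ¬ LineUnramifiedAt W p Φ₀) (heven : LineEven W p Φ₀)
    (hφ : φ.IsPrimitive) (hψ : ψ.IsPrimitive) (hpm : p ∣ m) (hpd : ¬ p ∣ d)
    (hφ0 : ∀ (σ : absoluteGaloisGroup ℚ), ∀ P ∈ Φ₀,
      σ • P = (φ ((modNCyclotomicCharacter ℚ m σ : (ZMod m)ˣ) : ZMod m)).val • P)
    (hψ0 : ∀ (σ : absoluteGaloisGroup ℚ) (P : W.geomTorsion (p : ℤ)),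
      σ • P - (ψ ((modNCyclotomicCharacter ℚ d σ : (ZMod d)ˣ) : ZMod d)).val • P ∈ Φ₀)
    (hS₀p : ∀ v ∈ S₀, ((p : ℕ) : 𝓞 ℚ) ∉ v.asIdeal)
    (hS : ∀ v : HeightOneSpectrum (𝓞 ℚ), v ∉ S₀ → ((p : ℕ) : 𝓞 ℚ) ∉ v.asIdeal → W.HasGoodReductionAt v)
    (hC1 : ‖characterLValueC p φ ∅ 1‖ = 1) (hD1 : ‖characterLValueD p ψ ∅ 1‖ = 1)
    (n : ℕ) (hn : n + ∑ v ∈ S₀, delta W p v =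
      ∑ v ∈ S₀, ((if φ (Rat.HeightOneSpectrum.natGenerator v : ZMod m) =
            (Rat.HeightOneSpectrum.natGenerator v : ZMod p)
          then sFactor p (Rat.HeightOneSpectrum.natGenerator v) else 0) +
        (if ψ (Rat.HeightOneSpectrum.natGenerator v : ZMod d) =
            (Rat.HeightOneSpectrum.natGenerator v : ZMod p)
          then sFactor p (Rat.HeightOneSpectrum.natGenerator v) else 0))) :
    X2.AnalyticMuLE W p 0 ∧ X2.AnalyticLambdaEq W p n := by
  have hred : ¬ W.HasIrreducibleModPGaloisRep p := not_hasIrreducibleModPGaloisRep_of_isRationalLine hΦ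
  -- the common core: every integral `b` with `ι b = ϖ·L` has unit content and `ord_T(b̄) = n`
  have core : ∀ {N : ℕ} [NeZero N] (f : CuspForm (Gamma0 N) 2), IsNewformOf W f →
      ∀ (ϖ : ℚ), (ϖ : ℝ) * W.realPeriodRat = plusPeriod f → ∀ (L : PowerSeries ℚ_[p]),
      (W.HasSplitMultiplicativeReductionAtPrime p → IsSplitMultPAdicLFunctionOf f p L) →
      (¬ W.HasSplitMultiplicativeReductionAtPrime p → IsMultPAdicLFunctionOf f p (-1) L) →
      ∀ (b : IwasawaAlgebra p), iwasawaToPowerSeries p b = PowerSeries.C ((ϖ : ℚ) : ℚ_[p]) * L →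
      HasUnitContent b ∧ (PowerSeries.map (PadicInt.toZMod (p := p)) b).order = (n : ℕ∞) := by
    intro N _ f hf ϖ hϖ L hLs hLns b hb
    obtain ⟨hbu, hord⟩ := hasUnitContent_and_order_eq_of_lineRamifiedEven_of_klFlat W p h311 f S₀ Φ₀ m φ
      d ψ hp2 hmult hΦ hram heven hf hφ hψ hpm hpd hφ0 hψ0 hS₀p hS hC1 hD1 ϖ hϖ L hLs hLns b hb
    refine ⟨hbu, ?_⟩
    rw [← hn, Nat.cast_add] at hord
    exact WithTop.add_right_cancel (ENat.coe_ne_top _) hord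
  refine ⟨?_, ?_⟩
  · intro N _ f hf ϖ hϖ L hLs hLns
    obtain ⟨b, hb⟩ := exists_integral_of_reducible W p hWu hp2 hmult hred f hf ϖ hϖ L hLs hLns
    obtain ⟨⟨k, hk⟩, -⟩ := core f hf ϖ hϖ L hLs hLns b hb
    refine ⟨k, ?_⟩
    rw [← hb, coeff_iwasawaToPowerSeries, PadicInt.padic_norm_e_of_padicInt, PadicInt.isUnit_iff.mp hk]
    have hp1 : (1 : ℝ) < p := by exact_mod_cast hp.out.one_lt
    simpa using zpow_lt_one_of_neg₀ hp1 (by norm_num : (-((0 : ℤ) + 1)) < 0)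
  · intro N _ f hf ϖ hϖ L hLs hLns G hG
    obtain ⟨hGu, hGo⟩ := core f hf ϖ hϖ L hLs hLns G hG
    have h := natCast_lam_eq_order_map_toZMod hGu
    rw [hGo] at h
    exact_mod_cast h

end Summit.BirchSwinnertonDyer.BirchSwinnertonDyer.Theorems.EisensteinPrimesLambdaFromCharacters

end
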